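import Literature.AlgebraicGeometry.Deformation.StandardSmoothLiftNilpotent
import Mathlib.AlgebraicGeometry.Morphisms.Etale
import Mathlib.AlgebraicGeometry.Morphisms.Smooth
import HarnessLib

/-!
# A smooth scheme over `Spec (A ⧸ J)` is covered by affine opens that lift to smooth affine `A`-schemes
# ([Oort1971] Lemma (2.2.4), scheme form of ★ `Deformation/StandardSmoothLiftNilpotent`)

Topic `Literature/AlgebraicGeometry/Deformation`; namespace `Literature.AlgebraicGeometry.Deformation.StandardSmoothLift`.  PROOF FILE
(theorems only: no definition, no instance, no notation, no named fact, no `sorry`).  Cell `hodgecm-mathlib` (D-0151), FLOOR 0, P6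
«MOD programme», generic organ (R1, scheme form) for `stub_L4B1u_abelianLiftOfIsUnitTwo` ((U)) and P6d's small-extension lifting.
`--supports stmt-HodgeConjecture-24832`; count-neutral: HC_CM is proved only modulo the printed citations until rung 0 closes.

* `exists_isStandardSmooth_appLE_top` — for a SMOOTH morphism `f : X → Y` to an AFFINE scheme, every point has arbitrarily small affine
  open neighbourhoods `V` with `Γ(Y, 𝒪) → Γ(X, V)` STANDARD SMOOTH (Mathlib `Smooth.exists_isStandardSmooth` gives `Γ(Y, U) → Γ(X, V)` for
  some affine `U ⊆ Y`; `Γ(Y, 𝒪) → Γ(Y, U)` is étale hence standard smooth; shrink by basic opens, which are localisations);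
* **`exists_affineOpen_smooth_lift`** — [Oort1971] (2.2.4) «locally `X′` can be lifted to `R`»: for `f₀ : X₀ → Spec (A ⧸ J)` smooth, `J`
  nilpotent, every point of `X₀` has arbitrarily small affine open neighbourhoods `V` together with a standard smooth `A`-algebra `B` and
  an `A ⧸ J`-isomorphism `(A ⧸ J) ⊗_A B ≅ Γ(X₀, V)` (★ `exists_isStandardSmooth_lift`).

## References
* [Oort1971] F. Oort, *Finite group schemes, local moduli for abelian varieties, and lifting problems*, Compositio Math. 23 (1971),
  Lemma (2.2.4) (p. 274).
* [StacksProject] The Stacks Project, Tag 00T6 (Algebra, Definition 10.137.5: standard smooth algebras).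
-/

noncomputable section

set_option backward.isDefEq.respectTransparency false

universe u

open CategoryTheory CategoryTheory.Limits AlgebraicGeometry TopologicalSpace TensorProduct

namespace Literature.AlgebraicGeometry.Deformation.StandardSmoothLift

/-- **Standard smooth affine neighbourhoods**: for a smooth morphism `f : X → Y` with `Y` affine, a point `x ∈ X` and an open `W ∋ x`,
there is an affine open `x ∈ V ⊆ W` with `Γ(Y, 𝒪_Y) → Γ(X, V)` standard smooth. [cite: StacksProject, Tag 00T6]
[cite: Oort1971, Lemma (2.2.4) (p. 274)] -/
theorem exists_isStandardSmooth_appLE_top {X Y : Scheme.{u}} (f : X ⟶ Y) [Smooth f] [IsAffine Y] (x : X)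
    (W : X.Opens) (hxW : x ∈ W) :
    ∃ (V : X.Opens), IsAffineOpen V ∧ x ∈ V ∧ V ≤ W ∧ (f.appLE ⊤ V le_top).hom.IsStandardSmooth := by
  obtain ⟨U, hU, V, hV, hxV, e, hstd⟩ := Smooth.exists_isStandardSmooth f x
  -- `Γ(Y, ⊤) → Γ(Y, U)` is étale, hence standard smooth
  have h1 : ((𝟙 Y : Y ⟶ Y).appLE ⊤ U le_top).hom.IsStandardSmooth :=
    RingHom.IsStandardSmoothOfRelativeDimension.isStandardSmooth _ _
      (RingHom.etale_iff_isStandardSmoothOfRelativeDimension_zero.mp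
        ((𝟙 Y : Y ⟶ Y).etale_appLE (isAffineOpen_top Y) hU le_top))
  have h2 : (f.appLE ⊤ V le_top).hom.IsStandardSmooth := by
    have hid : (𝟙 Y : Y ⟶ Y).appLE ⊤ U le_top = Y.presheaf.map (homOfLE (le_top : U ≤ ⊤)).op := by
      rw [Scheme.Hom.appLE, Scheme.Hom.id_app, Category.id_comp]
    have hcomp : (𝟙 Y : Y ⟶ Y).appLE ⊤ U le_top ≫ f.appLE U V e = f.appLE ⊤ V le_top := by
      rw [hid, Scheme.Hom.map_appLE]
    rw [← hcomp, CommRingCat.hom_comp]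
    exact RingHom.isStandardSmooth_stableUnderComposition _ _ h1 hstd
  -- shrink inside `W` by a basic open of `V`
  obtain ⟨s, hsW, hxs⟩ := hV.exists_basicOpen_le ⟨x, hxW⟩ hxV
  refine ⟨X.basicOpen s, hV.basicOpen s, hxs, hsW, ?_⟩
  haveI := hV.isLocalization_basicOpen s
  have h3 : (X.presheaf.map (homOfLE (X.basicOpen_le s)).op).hom.IsStandardSmooth :=
    RingHom.isStandardSmooth_holdsForLocalizationAway Γ(X, X.basicOpen s) s
  rw [← Scheme.Hom.appLE_map f le_top (homOfLE (X.basicOpen_le s)).op, CommRingCat.hom_comp]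
  exact RingHom.isStandardSmooth_stableUnderComposition _ _ h2 h3

/-- **[Oort1971] (2.2.4), local existence of lifts, scheme form**: let `J ⊆ A` be nilpotent and `f₀ : X₀ → Spec (A ⧸ J)` smooth.  Every
point `x ∈ X₀` has, inside any open `W ∋ x`, an affine open neighbourhood `V` such that the `A ⧸ J`-algebra `Γ(X₀, V)` (structure map
`A ⧸ J ≅ Γ(Spec (A ⧸ J)) → Γ(X₀, V)`) is `(A ⧸ J) ⊗_A B` for a STANDARD SMOOTH `A`-algebra `B`. [cite: Oort1971, Lemma (2.2.4) (p. 274)]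
[cite: StacksProject, Tag 00T6] -/
theorem exists_affineOpen_smooth_lift {A : Type u} [CommRing A] {J : Ideal A} (hJ : IsNilpotent J)
    {X₀ : Scheme.{u}} (f₀ : X₀ ⟶ Spec (.of (A ⧸ J))) [Smooth f₀] (x : X₀) (W : X₀.Opens) (hxW : x ∈ W) :
    ∃ (V : X₀.Opens) (_ : IsAffineOpen V) (_ : x ∈ V) (_ : V ≤ W)
      (B : Type u) (_ : CommRing B) (_ : Algebra A B) (_ : Algebra.IsStandardSmooth A B),
      letI : Algebra (A ⧸ J) Γ(X₀, V) := ((Scheme.ΓSpecIso (.of (A ⧸ J))).inv ≫ f₀.appLE ⊤ V le_top).hom.toAlgebra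
      Nonempty ((A ⧸ J) ⊗[A] B ≃ₐ[A ⧸ J] Γ(X₀, V)) := by
  obtain ⟨V, hV, hxV, hVW, hstd⟩ := exists_isStandardSmooth_appLE_top f₀ x W hxW
  letI alg : Algebra (A ⧸ J) Γ(X₀, V) := ((Scheme.ΓSpecIso (.of (A ⧸ J))).inv ≫ f₀.appLE ⊤ V le_top).hom.toAlgebra
  haveI : Algebra.IsStandardSmooth (A ⧸ J) Γ(X₀, V) :=
    RingHom.isStandardSmooth_respectsIso.2 (f₀.appLE ⊤ V le_top).hom
      (Scheme.ΓSpecIso (.of (A ⧸ J))).symm.commRingCatIsoToRingEquiv hstd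
  obtain ⟨B, _, _, hB, e⟩ := exists_isStandardSmooth_lift hJ Γ(X₀, V)
  exact ⟨V, hV, hxV, hVW, B, inferInstance, inferInstance, hB, e⟩

end Literature.AlgebraicGeometry.Deformation.StandardSmoothLift

end
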